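import Summits.CriticalPhenomena.CardyFormulaZ2.Theorems.CardyBoundaryCoulombGasBoundaryDefectGaussianRStubRealisabilityPart19
import Summits.CriticalPhenomena.CardyFormulaZ2.Theorems.CardyBoundaryCoulombGasBoundaryDefectGaussianRStubRealisabilityPart36

/-!
# Stub `stub_dictionaryPositivity` of line `rainbow-monomials-in-excursion-kernels` — Part 37:
# tracked cuts are strand ends (III): open targets are never cuts; cuts at a vertex of `V` are
# jump finishes; a free face touching a ghost leads to an active dart
# (crux `BoundaryDefectGaussianR`, stmt-CriticalPhenomena-14132; insertion dictionary D2, layer 3b)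

Third of four files on hypothesis (E1) of the rainbow forcing (Part 18); notation of Part 36. For a
tracked corner `c = (x, k)` of the jump collar with frozen target edge `e`:

* `tc_turnConsistent_of_open` — if `e` is frozen OPEN, the turn at `c` is consistent for the
  prescribed data (both endpoints of `e` are prescribed vertex-cells at the same level, Lemma C:
  Parts 13 and 34), so `c` is NOT a cut;
* `tc_vertex_closed_end` — if `x = v ∈ V` and `e = {v, v + dir K}` is closed (so `c = (v, K + 3)`,
  the corner in the face before the exterior dart `(v, K)`), a cut at `c` means that the two collar
  faces before and after `(v, K)` carry different levels (Lemma C, Part 13); faces of darts off the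
  cycle and faces of darts on wired stretches being excluded (default level / spokes), `(v, K)` is
  a dart of the cycle, free on both sides, where the level changes: a JUMP, and `c` its registered
  FINISH `(v, K + 3)`;
* `tc_free_touch` — if a ghost `g` is a corner of the gap face of a dart `ds[s]` that is free on
  both sides, then some ACTIVE dart of the cycle touches `g` (the entry mentioning `g` lies on a
  wired stretch and its dart is within two steps of `ds[s]` along the cycle, by the chain lemma of
  Part 32; the wiredness changes in between).

Registered one-line form: `s14_trackedCuts_vertex`. All [folklore].
-/

namespace Summit.CriticalPhenomena.CardyFormulaZ2.Cruxes.BoundaryDefectGaussianR.RainbowMonomialsInExcursionKernels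

open Literature.Probability.LatticeModels Literature.Probability.LatticeModels.CollarLegModel

/-! ### Open targets are never cuts -/

/-- **A tracked corner whose target is a frozen OPEN edge is a consistent turn of the prescribed
data** (admissible insertion, FLAT insertion points, local CHARTS): the next corner sits at the
other endpoint of the edge, a prescribed vertex-cell, in the same face, and the two endpoint
levels agree (`openEdges_vertH_eq`, Part 34). Hence open targets are never cuts. [folklore] -/
theorem tc_turnConsistent_of_open (ι : LegInsertionData) (V : Finset (ℤ × ℤ)) (hadm : ι.IsAdmissible V)
    (hflat : ∀ x ∈ insert ι.sink ι.source, ∃ dvec : ℤ × ℤ,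
      (dvec = (1, 0) ∨ dvec = (-1, 0) ∨ dvec = (0, 1) ∨ dvec = (0, -1)) ∧
      ∀ v : ℤ × ℤ, (v.1 - x.1) ^ 2 + (v.2 - x.2) ^ 2 ≤ ((ι.sinkLegs : ℤ) + 3) ^ 2 →
        (v ∈ V ↔ 0 ≤ (v.1 - x.1) * dvec.1 + (v.2 - x.2) * dvec.2))
    (hchart : ∀ u ∈ V, ∀ k : Fin 4, u + dir k ∉ V → ∃ (K : Fin 4) (c₁ c₂ : ℤ),
      (∀ v : ℤ × ℤ, |v.1 - u.1| ≤ 3 → |v.2 - u.2| ≤ 3 →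
        (v ∈ V ↔ c₂ ≤ v.1 * (dir (K + 1)).1 + v.2 * (dir (K + 1)).2)) ∨
      (∀ v : ℤ × ℤ, |v.1 - u.1| ≤ 3 → |v.2 - u.2| ≤ 3 →
        (v ∈ V ↔ c₁ ≤ v.1 * (dir K).1 + v.2 * (dir K).2 ∧
          c₂ ≤ v.1 * (dir (K + 1)).1 + v.2 * (dir (K + 1)).2)) ∨
      (∀ v : ℤ × ℤ, |v.1 - u.1| ≤ 3 → |v.2 - u.2| ≤ 3 →
        (v ∈ V ↔ c₂ ≤ v.1 * (dir (K + 1)).1 + v.2 * (dir (K + 1)).2 ∨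
          v.1 * (dir K).1 + v.2 * (dir K).2 ≤ c₁)))
    {c : Site 2 × Fin 4} (htr : (ι.model V).IsTracked c) (hm : cTgt c ∈ (ι.model V).cfgOf ∅) :
    (ι.model V).TurnConsistent (fun _ => 0) ((ι.model V).cfgOf ∅) c := by
  obtain ⟨e, hc⟩ := exists_eq_cIn_or_cOut c
  have hedge : cTgt c = edgeSym2 e := by
    rcases hc with rfl | rfl
    exacts [cTgt_cIn e, cTgt_cOut e]
  have ho : e ∈ (ι.model V).openEdges := by
    rcases ((ι.model V).edgeSym2_mem_cfgOf_iff ∅ e).1 (hedge ▸ hm) with h0 | h0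
    · simp at h0
    · exact h0
  have hlev := openEdges_vertH_eq ι V hadm hflat hchart ho
  have hhv := openEdges_hv_eq (ι.model V) ho (fun _ => 0)
  have hends : e.1 ∈ (ι.model V).vertexCells ∧ SixVertex.edgeTip e ∈ (ι.model V).vertexCells := by
    have ho' := ho
    rw [openEdges, Finset.mem_filter] at ho'
    rcases ho'.2 with ⟨h1, h2⟩ | ⟨h1, h2⟩ | ⟨h1, h2, p, hp, hep⟩
    · exact ⟨Finset.mem_union_left _ (Finset.mem_inter.1 h1).2, Finset.mem_union_right _ h2⟩
    · exact ⟨Finset.mem_union_right _ h2, Finset.mem_union_left _ (Finset.mem_inter.1 h1).2⟩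
    · obtain ⟨hc1, hc2⟩ := se_mem_faceEdges_corners hep
      exact ⟨Finset.mem_union_right _ (tc_ghost_of_pocketCorner _ hp hc1 h1),
        Finset.mem_union_right _ (tc_ghost_of_pocketCorner _ hp hc2 h2)⟩
  refine ⟨htr, ⟨?_, ?_⟩, fun _ => ?_, fun hn => absurd hm hn⟩
  · rw [nextCorner_of_mem hm]
    rcases hc with rfl | rfl
    · simp only [ofSite_cIn_fst_add]; exact hends.2
    · simp only [ofSite_cOut_fst_add]; exact hends.1
  · rw [cFace_nextCorner_of_mem hm]; exact htr.2
  · rw [nextCorner_of_mem hm]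
    rcases hc with rfl | rfl
    · simp only [ofSite_cIn_fst, ofSite_cIn_fst_add]
      rw [hhv.1, hhv.2, hlev]
    · simp only [ofSite_cOut_fst, ofSite_cOut_fst_add]
      rw [hhv.1, hhv.2, hlev]

section Admissible

variable (ι : LegInsertionData) (V : Finset (ℤ × ℤ)) {d₀ : Dart} (hadm : ι.IsAdmissible V)
  (h : outDart V ι.sink = some d₀) {st : ℕ → WalkState}
  (hst : ∀ t, st t = List.foldl (fun s d => s.step (ι.startAt V d)) ι.init ((cycle V d₀).take t))

/-! ### Cuts at a vertex of `V` are jump finishes -/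

include hadm h hst in
/-- **A cut at a vertex of `V` is the finish of a jump edge.** For `v ∈ V` with `v + dir K ∉ V`
(admissible insertion, flat insertion points, pinch-free `V`): if the corner `(v, K + 3)` — the
corner at `v` in the face before the exterior dart `(v, K)`, targeting the exterior edge
`{v, v + dir K}` — has its target closed in `cfgOf ∅` and is a cut, then `(v, K)` is a jump dart
of the collar walk and `((v, K + 3), m) ∈ strandEnds` for its tag `m`. [folklore] -/
theorem tc_vertex_closed_end
    (hnp : ∀ x y : ℤ, ((x, y) ∈ V → (x + 1, y + 1) ∈ V → (x + 1, y) ∈ V ∨ (x, y + 1) ∈ V) ∧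
      ((x + 1, y) ∈ V → (x, y + 1) ∈ V → (x, y) ∈ V ∨ (x + 1, y + 1) ∈ V))
    {v : ℤ × ℤ} (hvV : v ∈ V) {K : Fin 4} (hvK : v + dir K ∉ V)
    (hcl : cTgt (toSite v, K + 3) ∉ (ι.model V).cfgOf ∅) (hcut : (ι.model V).IsCut (toSite v, K + 3)) :
    ∃ m : ℤ, ((toSite v, K + 3), m) ∈ ι.strandEnds V := by
  have hP := length_cycle_pos ι V hadm h
  obtain ⟨e, hc, hend⟩ := se_corner_edge v (K + 3)
  rw [(tp_fin4 K).2.2.1] at hend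
  have hno : e ∉ (ι.model V).openEdges := fun ho => hcl ((se_cTgt_mem_cfgOf_iff _ _ hc).2 (Or.inr ho))
  have hvVC : v ∈ (ι.model V).vertexCells := Finset.mem_union_left _ hvV
  have hfr : e ∈ (ι.model V).frozenEdges := by
    rw [frozenEdges, Finset.mem_sdiff, SixVertex.mem_edges_iff, E, inducedEdges, Finset.mem_filter]
    rcases hend with ⟨h1, h2⟩ | ⟨h1, h2⟩ <;> rw [h1, h2]
    · exact ⟨Or.inl hvVC, fun hh => hvK hh.2.2⟩
    · exact ⟨Or.inr hvVC, fun hh => hvK hh.2.1⟩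
  -- the two side faces are prescribed collar faces (Lemma C)
  have hfa : (ι.model V).hf (fun _ => 0) (gapFace (v, K)) = (ι.model V).C.faceH (gapFace (v, K)) ∧
      (ι.model V).hf (fun _ => 0) (gapFace (v - dir (K + 1), K)) =
        (ι.model V).C.faceH (gapFace (v - dir (K + 1), K)) := by
    rcases tc_leftFaces_of_dart v K hend with ⟨h1, h2⟩ | ⟨h1, h2⟩
    · exact ⟨h1 ▸ closed_hf_eq ι V hadm hnp hfr hno true _, h2 ▸ closed_hf_eq ι V hadm hnp hfr hno false _⟩
    · exact ⟨h1 ▸ closed_hf_eq ι V hadm hnp hfr hno false _, h2 ▸ closed_hf_eq ι V hadm hnp hfr hno true _⟩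
  -- a cut: the two levels differ
  obtain ⟨gf1, -, gf3, -⟩ := se_gapFace_eq_cFace v K
  have htr3 : (ι.model V).IsTracked (toSite v, K + 3) :=
    ⟨by simpa using hvVC, by rw [← gf3]; exact mem_faceCells_of_mem_vertexFaces _ hvV (se_gapFace_mem_vertexFaces v K).2.1⟩
  have htr0 : (ι.model V).IsTracked (toSite v, K + 3 + 1) := by
    rw [(tp_fin4 K).2.2.1]
    exact ⟨by simpa using hvVC, by rw [← gf1]; exact mem_faceCells_of_mem_vertexFaces _ hvV (se_gapFace_mem_vertexFaces v K).1⟩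
  have hne : (ι.collar V).faceH (gapFace (v - dir (K + 1), K)) ≠ (ι.collar V).faceH (gapFace (v, K)) := by
    intro heq
    apply hcut.2
    refine ⟨htr3, ?_, fun hm => absurd hm hcl, fun _ => ?_⟩
    · rw [nextCorner_of_not_mem hcl]
      exact htr0
    · rw [nextCorner_of_not_mem hcl]
      show (ι.model V).hf _ (ofSite (cFace (toSite v, K + 3))) = (ι.model V).hf _ (ofSite (cFace (toSite v, K + 3 + 1)))
      rw [(tp_fin4 K).2.2.1, ← gf3, ← gf1, hfa.1, hfa.2]
      exact heq
  by_cases hex : ∃ (t : ℕ) (_ : t < (cycle V d₀).length), (cycle V d₀)[t] = (v, K)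
  · obtain ⟨t, ht, hds⟩ := hex
    -- the dart is free on both sides (else the edge is a spoke, open)
    have hfree : (st t).wired = false ∧ (st (t + 1)).wired = false := by
      by_contra hw
      have hw' : (st t).wired = true ∨ (st (t + 1)).wired = true := by
        cases h0 : (st t).wired <;> cases h1 : (st (t + 1)).wired <;> simp_all
      have harc : v ∈ (ι.collar V).arc := (mem_collar_arc_iff ι V h hst).2 ⟨t, ht, hw', by rw [hds]⟩
      exact hno (tc_spoke_open _ (Finset.mem_inter.2 ⟨harc, hvV⟩) hvK hend).2
    have huniq : ∀ (t₁ t₂ : ℕ) (h₁ : t₁ < (cycle V d₀).length) (h₂ : t₂ < (cycle V d₀).length),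
        gapFace (cycle V d₀)[t₁] = gapFace (cycle V d₀)[t₂] → t₁ = t₂ := by
      intro t₁ t₂ h₁ h₂ hg
      obtain ⟨hu₁, hg₁⟩ := cycle_getElem_exterior ι V hadm h h₁
      obtain ⟨hu₂, hg₂⟩ := cycle_getElem_exterior ι V hadm h h₂
      exact se_cycle_index_inj ι V hadm h h₁ h₂ (tc_gapFace_inj hnp hu₂ hg₂ hu₁ hg₁ hg)
    -- the level after the dart
    have hA : (ι.collar V).faceH (gapFace (v, K)) = (st (t + 1)).level := by
      have := collar_faceH_gapFace ι V h hst ht hfree.2 fun t' ht' _ hg => ?_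
      · rwa [hds] at this
      · exfalso; have := huniq t' t (by omega) ht hg; omega
    -- the level before the dart, via the predecessor
    have htp : (t + (cycle V d₀).length - 1) % (cycle V d₀).length < (cycle V d₀).length := Nat.mod_lt _ hP
    have hsucc := succ_pred_mod ht
    have hdsucc : dsucc V (cycle V d₀)[(t + (cycle V d₀).length - 1) % (cycle V d₀).length] = (v, K) := by
      rw [← getElem_succ_mod ι V hadm h htp]
      simp only [hsucc]
      exact hds
    obtain ⟨hlp, hwp⟩ := st_mod_succ ι V hadm h hst htp
    simp only [hsucc] at hlp hwp
    have hB : (ι.collar V).faceH (gapFace (v - dir (K + 1), K)) = (st t).level := by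
      rw [← tc_gapFace_of_dsucc hdsucc, hlp]
      exact collar_faceH_gapFace ι V h hst htp (by rw [← hwp]; exact hfree.1) fun t' ht' _ hg => by
        exfalso; have := huniq t' _ (by omega) htp hg; omega
    -- an active dart free on both sides: a jump
    have hact : (st (t + 1)).level ≠ (st t).level := by rw [← hA, ← hB]; exact hne.symm
    obtain ⟨-, -, hnjw⟩ := se_active_delta ι V hst ht hact
    have hj : (st (t + 1)).level = (st t).level + 2 ∨ (st t).level = (st (t + 1)).level + 2 := by
      by_contra hnj
      have := hnjw hnj
      rw [hfree.1, hfree.2] at this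
      exact absurd this (by decide)
    refine ⟨min (st t).level (((st t).level + (st (t + 1)).level) / 2),
      (se_mem_strandEnds_iff ι V h hst).2 ⟨t, ht, ?_⟩⟩
    rw [hds, se_endsAt_jump _ _ _ hj]
    exact List.mem_cons_self
  · -- the dart is not on the cycle: both faces carry the default level
    exfalso
    apply hne
    have hA : (ι.collar V).faceH (gapFace (v, K)) = 0 := by
      refine collar_faceH_eq_zero ι V h hst fun t ht _ hg => hex ⟨t, ht, ?_⟩
      obtain ⟨hu₁, hg₁⟩ := cycle_getElem_exterior ι V hadm h ht
      exact tc_gapFace_inj hnp (d := (v, K)) hvV hvK hu₁ hg₁ hg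
    obtain ⟨d', hd1', hd2', hdsucc'⟩ := tc_exists_pred V (d := (v, K)) hvV hvK
    have hB : (ι.collar V).faceH (gapFace (v - dir (K + 1), K)) = 0 := by
      rw [← tc_gapFace_of_dsucc hdsucc']
      refine collar_faceH_eq_zero ι V h hst fun t ht _ hg => hex ⟨(t + 1) % (cycle V d₀).length, Nat.mod_lt _ hP, ?_⟩
      obtain ⟨hu₁, hg₁⟩ := cycle_getElem_exterior ι V hadm h ht
      rw [getElem_succ_mod ι V hadm h ht, tc_gapFace_inj hnp hd1' hd2' hu₁ hg₁ hg, hdsucc']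
    rw [hA, hB]

/-! ### A free face touching a ghost leads to an active dart -/

include hadm h hst in
/-- **A ghost on a free gap face is touched by an active dart.** If `g` is a corner of the gap
face of a dart `ds[s]` which is FREE on both sides, and `g` is mentioned by the entry `tm` of the
walk (so `ds[tm]` touches `g` and lies on a wired stretch), then — `V` being locally charted — the
two darts are at most two steps apart along the cycle and the wiredness changes between them:
some dart touching `g` is active. [folklore] -/
theorem tc_free_touch
    (hchart : ∀ u ∈ V, ∀ k : Fin 4, u + dir k ∉ V → ∃ (K : Fin 4) (c₁ c₂ : ℤ),
      (∀ v : ℤ × ℤ, |v.1 - u.1| ≤ 3 → |v.2 - u.2| ≤ 3 →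
        (v ∈ V ↔ c₂ ≤ v.1 * (dir (K + 1)).1 + v.2 * (dir (K + 1)).2)) ∨
      (∀ v : ℤ × ℤ, |v.1 - u.1| ≤ 3 → |v.2 - u.2| ≤ 3 →
        (v ∈ V ↔ c₁ ≤ v.1 * (dir K).1 + v.2 * (dir K).2 ∧
          c₂ ≤ v.1 * (dir (K + 1)).1 + v.2 * (dir (K + 1)).2)) ∨
      (∀ v : ℤ × ℤ, |v.1 - u.1| ≤ 3 → |v.2 - u.2| ≤ 3 →
        (v ∈ V ↔ c₂ ≤ v.1 * (dir (K + 1)).1 + v.2 * (dir (K + 1)).2 ∨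
          v.1 * (dir K).1 + v.2 * (dir K).2 ≤ c₁)))
    {g : ℤ × ℤ} {s : ℕ} (hs : s < (cycle V d₀).length)
    (hgs : g ∈ SixVertex.faceCorners (gapFace (cycle V d₀)[s]))
    (hw0 : (st s).wired = false) (hw1 : (st (s + 1)).wired = false)
    {tm : ℕ} (htm : tm < (cycle V d₀).length)
    (hm : LegInsertionData.mention V g ((cycle V d₀)[tm], st tm, st (tm + 1)) ≠ none) :
    ∃ (ta : ℕ) (_ : ta < (cycle V d₀).length), (st (ta + 1)).level ≠ (st ta).level ∧
      g ∈ SixVertex.faceCorners (gapFace (cycle V d₀)[ta]) := by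
  have hP := length_cycle_pos ι V hadm h
  have hgm := touch_of_mention V hm
  have hW := wired_of_mention V htm hm
  obtain ⟨hu, hgt⟩ := cycle_getElem_exterior ι V hadm h htm
  obtain ⟨hu', hgt'⟩ := cycle_getElem_exterior ι V hadm h hs
  have hch := chart_of_bdry_chart hchart hu hgt hgm
  rcases touch_chain hch hu hgt hu' hgt' hgm hgs with he | he | he | ⟨e₃, hu₃, hg₃, hx₃, he⟩
  · obtain rfl := se_cycle_index_inj ι V hadm h htm hs he
    rw [hw0, hw1] at hW
    simp at hW
  · -- `ds[s]` is the dart after `ds[tm]`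
    have hidx : s = (tm + 1) % (cycle V d₀).length :=
      se_cycle_index_inj ι V hadm h hs (Nat.mod_lt _ hP) (by rw [he, getElem_succ_mod ι V hadm h htm])
    subst hidx
    obtain ⟨-, hsw⟩ := st_mod_succ ι V hadm h hst htm
    rw [hsw] at hw0
    refine ⟨tm, htm, tc_level_ne_of_wired_ne ι V hst htm ?_, hgm⟩
    rcases hW with hw | hw
    · rw [hw, hw0]; decide
    · rw [hw0] at hw; exact absurd hw (by decide)
  · -- `ds[tm]` is the dart after `ds[s]`
    have hidx : tm = (s + 1) % (cycle V d₀).length :=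
      se_cycle_index_inj ι V hadm h htm (Nat.mod_lt _ hP) (by rw [he, getElem_succ_mod ι V hadm h hs])
    subst hidx
    obtain ⟨-, hsw⟩ := st_mod_succ ι V hadm h hst hs
    refine ⟨_, htm, tc_level_ne_of_wired_ne ι V hst htm ?_, hgm⟩
    rcases hW with hw | hw
    · rw [hsw, hw1] at hw; exact absurd hw (by decide)
    · rw [hw, hsw, hw1]; decide
  · rcases he with ⟨h31, h32⟩ | ⟨h31, h32⟩
    · -- `ds[s]` two darts after `ds[tm]`, `e₃` in between
      have hlt : (tm + 1) % (cycle V d₀).length < (cycle V d₀).length := Nat.mod_lt _ hP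
      have h3 : e₃ = (cycle V d₀)[(tm + 1) % (cycle V d₀).length]'hlt := by
        rw [h31, getElem_succ_mod ι V hadm h htm]
      have hidx : s = ((tm + 1) % (cycle V d₀).length + 1) % (cycle V d₀).length :=
        se_cycle_index_inj ι V hadm h hs (Nat.mod_lt _ hP) (by rw [h32, h3, getElem_succ_mod ι V hadm h hlt])
      subst hidx
      obtain ⟨-, hsw⟩ := st_mod_succ ι V hadm h hst htm
      obtain ⟨-, hsw'⟩ := st_mod_succ ι V hadm h hst hlt
      rw [hsw'] at hw0
      cases hwu : (st ((tm + 1) % (cycle V d₀).length)).wired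
      · rw [hsw] at hwu
        refine ⟨tm, htm, tc_level_ne_of_wired_ne ι V hst htm ?_, hgm⟩
        rcases hW with hw | hw
        · rw [hw, hwu]; decide
        · rw [hwu] at hw; exact absurd hw (by decide)
      · refine ⟨(tm + 1) % (cycle V d₀).length, hlt,
          tc_level_ne_of_wired_ne ι V hst hlt (by rw [hw0, hwu]; decide), ?_⟩
        rw [← h3]; exact hx₃
    · -- `ds[tm]` two darts after `ds[s]`, `e₃` in between
      have hlt : (s + 1) % (cycle V d₀).length < (cycle V d₀).length := Nat.mod_lt _ hP
      have h3 : e₃ = (cycle V d₀)[(s + 1) % (cycle V d₀).length]'hlt := by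
        rw [h31, getElem_succ_mod ι V hadm h hs]
      have hidx : tm = ((s + 1) % (cycle V d₀).length + 1) % (cycle V d₀).length :=
        se_cycle_index_inj ι V hadm h htm (Nat.mod_lt _ hP) (by rw [h32, h3, getElem_succ_mod ι V hadm h hlt])
      subst hidx
      obtain ⟨-, hsw⟩ := st_mod_succ ι V hadm h hst hs
      obtain ⟨-, hsw'⟩ := st_mod_succ ι V hadm h hst hlt
      cases hwu : (st ((s + 1) % (cycle V d₀).length + 1)).wired
      · refine ⟨_, htm, tc_level_ne_of_wired_ne ι V hst htm ?_, hgm⟩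
        rcases hW with hw | hw
        · rw [hsw', hwu] at hw; exact absurd hw (by decide)
        · rw [hw, hsw', hwu]; decide
      · refine ⟨(s + 1) % (cycle V d₀).length, hlt,
          tc_level_ne_of_wired_ne ι V hst hlt (by rw [hwu, hsw, hw1]; decide), ?_⟩
        rw [← h3]; exact hx₃

end Admissible

/-! ### Registered one-line form -/

/-- **Sub-goal `s14_trackedCuts_vertex`** (registered on stmt-CriticalPhenomena-14132): for an
admissible leg insertion with FLAT insertion points on a PINCH-FREE `V`, a cut at a corner
`(v, K + 3)` of a vertex `v ∈ V` with `v + dir K ∉ V`, whose target (the exterior edge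
`{v, v + dir K}`) is closed in the completed configuration of no live edge, is a registered strand
end (the finish of the jump edge at the dart `(v, K)` of the collar walk). [folklore] -/
theorem s14_trackedCuts_vertex : ∀ (ι : Literature.Probability.LatticeModels.CollarLegModel.LegInsertionData) (V : Finset (ℤ × ℤ)), ι.IsAdmissible V → (∀ x y : ℤ, ((x, y) ∈ V → (x + 1, y + 1) ∈ V → (x + 1, y) ∈ V ∨ (x, y + 1) ∈ V) ∧ ((x + 1, y) ∈ V → (x, y + 1) ∈ V → (x, y) ∈ V ∨ (x + 1, y + 1) ∈ V)) → ∀ (v : ℤ × ℤ) (K : Fin 4), v ∈ V → v + Literature.Probability.LatticeModels.CollarLegModel.dir K ∉ V → Literature.Probability.LatticeModels.cTgt (Literature.Probability.LatticeModels.CollarLegModel.toSite v, K + 3) ∉ (ι.model V).cfgOf ∅ → (ι.model V).IsCut (Literature.Probability.LatticeModels.CollarLegModel.toSite v, K + 3) → ∃ m : ℤ, ((Literature.Probability.LatticeModels.CollarLegModel.toSite v, K + 3), m) ∈ ι.strandEnds V := by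
  intro ι V hadm hnp v K hvV hvK hcl hcut
  obtain ⟨d₀, h, -⟩ := s3_of_admissible ι V hadm
  exact tc_vertex_closed_end ι V hadm h (st := fun t => List.foldl (fun s d => s.step (ι.startAt V d)) ι.init
    ((cycle V d₀).take t)) (fun _ => rfl) hnp hvV hvK hcl hcut

end Summit.CriticalPhenomena.CardyFormulaZ2.Cruxes.BoundaryDefectGaussianR.RainbowMonomialsInExcursionKernels
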